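import Summits.RiemannHypothesis.RiemannHypothesis.Theses.GroundBarta
import Summits.RiemannHypothesis.RiemannHypothesis.Theorems.GroundBartaPolarPerronFrobeniusRobustBarta
import Summits.RiemannHypothesis.RiemannHypothesis.Theorems.GroundBartaGroundBartaFloorRateDecay
import Summits.RiemannHypothesis.RiemannHypothesis.Theorems.GroundBartaPolarPerronFrobeniusEvenRealGroundState
import Summits.RiemannHypothesis.RiemannHypothesis.Theorems.GroundBartaOddNegativityOffLine
import HarnessLib

/-!
# The ROBUST ground Barta floor and the robust form of crux `PolarPerronFrobenius`
(route `RiemannHypothesis/GroundBarta`, crux stmt-RiemannHypothesis-18390; helper / restatement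
candidate — RH-free)

Write, for a ground state `u` of the full windowed Weil form at `a`, `v = 𝟙_{(-a,a)} Re u`,
`v⁺ = max(v,0)`, `v⁻ = max(-v,0)`, `Φ = weilThetaPhi`, `e = groundBartaRate` and
`R_a(w) = Π_a ∫ w + Φ(a)(4√(∫ w²) + 8∫ w)`, `Π_a = 2Σ' Λ(n) n^{-1/2} Φ(max a (log n − a))`.
Call `u` ROBUSTLY SIGNED at `a` if `Im u = 0` a.e. on `(-a, a)`, `∫ v⁻Φ ≤ (1/3)∫ v⁺Φ` and
`R_a(v⁻) ≤ (1/3) e(a) ∫ v⁺Φ` — a `Φ`-weighted (bulk) sign-dominance condition that every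
non-negative real ground state satisfies trivially and that tolerates sign excursions of any
polynomial amplitude in the edge layers (all weights against `v⁻` are `O(Φ(a)e^{a})`).

* `robustBarta_floor` — at a window carrying a robustly signed ground state, `ε(a) ≥ -2e(a)`
  (`robustBarta_weilGroundEnergy_mul_ge` + algebra).
* `robustGroundBartaFloor` — THE ROBUST RUNG: with `e' = 2·groundBartaRate → 0` and `a₀ = 1`, at
  every window `a ≥ 1` carrying a robustly signed ground state every normalised window test has
  `Re Q ≥ -e'(a)` (compare the rung `GroundBartaFloor_of`, which asks `Re u ≥ 0` a.e.).
* `riemannHypothesis_of_cofinal_robustGroundState` — DECIDING THEOREM of the robust route: if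
  beyond every height some window carries a robustly signed ground state, the Riemann Hypothesis
  holds (robust rung + the proved detector `OddNegativityOffLine`; no parity statement is consumed).
* `riemannHypothesis_of_robustPolarPerronFrobenius` — the route-shaped form: the ROBUST twin of
  `PolarPerronFrobenius` (`∀ A, ∃ a ≥ A, EW a → ∃` robustly signed ground state), together with
  `EvenWinsBeyondArch`, implies RH.  The robust twin is implied by `PolarPerronFrobenius`
  (`robustPolarPerronFrobenius_of_polarPerronFrobenius`), so it is a WEAKER sufficient crux, immune to
  the route's kill criterion k2 (edge holes at scale `e^{-2πe^{2a}}`).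
References: Bombieri 2000 §4; Barta 1937 via López-Gómez doi:10.1142/8664 p.175; Yoshida 1992
(odd criterion).  RH-free; Mathlib + landed tree files only; no definitions.
-/

set_option linter.dupNamespace false

noncomputable section

open Set MeasureTheory Filter Complex
open scoped Real Topology ComplexConjugate ArithmeticFunction.vonMangoldt

namespace Summit.RiemannHypothesis.RiemannHypothesis.Theorems.GroundBartaFloor

open Literature.NumberTheory.LFunctions
open Summit.RiemannHypothesis.RiemannHypothesis.Theorems.GroundStatesConvergeToXi

/-! ## The robust floor at a window -/

/-- **Robust floor at a window.**  If a window `a > 0` carries a ground state `u` with `Im u = 0`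
a.e. on `(-a, a)` whose negative part `v⁻ = max(-𝟙_{(-a,a)}Re u, 0)` is `Φ`-small against the
positive part `v⁺`:  `∫ v⁻Φ ≤ (1/3)∫ v⁺Φ` and
`Π_a ∫ v⁻ + Φ(a)(4√(∫(v⁻)²) + 8∫ v⁻) ≤ (1/3) e(a) ∫ v⁺Φ`, then `ε(a) ≥ -2 e(a)`.  For a
NON-NEGATIVE real ground state both hypotheses are trivial (`v⁻ = 0`), recovering the rung's floor
up to the factor `2`. [cite: Bombieri2000Weil, §4 Lemma 1] -/
theorem robustBarta_floor {a : ℝ} (ha : 0 < a) {u : ℝ → ℂ} (hu : IsWeilGroundState a u)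
    (hreal : ∀ᵐ t : ℝ, t ∈ Ioo (-a) a → (u t).im = 0)
    (hneg : (∫ t, max (-(Ioo (-a) a).indicator (fun t => (u t).re) t) 0 * weilThetaPhi t) ≤
      (1 / 3) * (∫ t, max ((Ioo (-a) a).indicator (fun t => (u t).re) t) 0 * weilThetaPhi t))
    (hleak : (2 * ∑' n : ℕ, (Λ n : ℝ) / Real.sqrt n * weilThetaPhi (max a (Real.log n - a))) *
          (∫ t, max (-(Ioo (-a) a).indicator (fun t => (u t).re) t) 0) +
        weilThetaPhi a *
          (4 * Real.sqrt (∫ t, max (-(Ioo (-a) a).indicator (fun t => (u t).re) t) 0 ^ 2) +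
            8 * (∫ t, max (-(Ioo (-a) a).indicator (fun t => (u t).re) t) 0)) ≤
      (1 / 3) * (groundBartaRate a *
        (∫ t, max ((Ioo (-a) a).indicator (fun t => (u t).re) t) 0 * weilThetaPhi t))) :
    -(2 * groundBartaRate a) ≤ weilGroundEnergy a := by
  have hmain := robustBarta_weilGroundEnergy_mul_ge ha hu hreal
  set v : ℝ → ℝ := (Ioo (-a) a).indicator fun t => (u t).re with hv
  set vp : ℝ → ℝ := fun t => max (v t) 0 with hvp
  set vm : ℝ → ℝ := fun t => max (-v t) 0 with hvm
  set R : ℝ := (2 * ∑' n : ℕ, (Λ n : ℝ) / Real.sqrt n * weilThetaPhi (max a (Real.log n - a))) *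
      (∫ t, vm t) + weilThetaPhi a * (4 * Real.sqrt (∫ t, vm t ^ 2) + 8 * ∫ t, vm t) with hR
  set P : ℝ := ∫ t, vp t * weilThetaPhi t with hP
  set N : ℝ := ∫ t, vm t * weilThetaPhi t with hN
  change N ≤ 1 / 3 * P at hneg
  change R ≤ 1 / 3 * (groundBartaRate a * P) at hleak
  change -(groundBartaRate a * P + R) ≤ weilGroundEnergy a * (∫ t, v t * weilThetaPhi t) at hmain
  have he0 : 0 ≤ groundBartaRate a := groundBartaRate_nonneg a
  -- the positive part and its moment
  have hvp0 : ∀ t, 0 ≤ vp t := fun t => le_max_right _ _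
  have hvm0 : ∀ t, 0 ≤ vm t := fun t => le_max_right _ _
  have hP0 : 0 ≤ P := integral_nonneg fun t => mul_nonneg (hvp0 t) (weilThetaPhi_pos t).le
  have hN0 : 0 ≤ N := integral_nonneg fun t => mul_nonneg (hvm0 t) (weilThetaPhi_pos t).le
  -- `∫ vΦ = P - N`
  obtain ⟨hu2, -⟩ := id hu
  have hv_le : ∀ t, |v t| ≤ ‖u t‖ := fun t => by
    by_cases ht : t ∈ Ioo (-a) a
    · simp only [hv, indicator_of_mem ht]
      exact Complex.abs_re_le_norm _
    · simp only [hv, indicator_of_notMem ht, abs_zero]; exact norm_nonneg _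
  have hv_meas : AEStronglyMeasurable v volume :=
    (Complex.continuous_re.comp_aestronglyMeasurable hu2.1).indicator measurableSet_Ioo
  have hmom : ∀ {w : ℝ → ℝ}, AEStronglyMeasurable w volume → (∀ t, |w t| ≤ ‖u t‖) →
      Integrable fun t => w t * weilThetaPhi t := by
    intro w hw hwle
    refine Integrable.mono' (hu.integrable.norm.mul_const (weilThetaPhi 0))
      (hw.mul continuous_weilThetaPhi.aestronglyMeasurable) (Eventually.of_forall fun t => ?_)
    rw [Real.norm_eq_abs, abs_mul, abs_of_pos (weilThetaPhi_pos t)]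
    exact mul_le_mul (hwle t) (gbf_weilThetaPhi_le_zero_val t) (weilThetaPhi_pos t).le
      (norm_nonneg _)
  have hvp_le : ∀ t, |vp t| ≤ ‖u t‖ := fun t => by
    rw [abs_of_nonneg (hvp0 t)]
    exact (max_le (le_abs_self _) (abs_nonneg _)).trans (hv_le t)
  have hvm_le : ∀ t, |vm t| ≤ ‖u t‖ := fun t => by
    rw [abs_of_nonneg (hvm0 t)]
    exact (max_le (neg_le_abs _) (abs_nonneg _)).trans (hv_le t)
  have hvp_meas : AEStronglyMeasurable vp volume := hv_meas.sup aestronglyMeasurable_const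
  have hvm_meas : AEStronglyMeasurable vm volume := hv_meas.neg.sup aestronglyMeasurable_const
  have hvpΦ := hmom hvp_meas hvp_le
  have hvmΦ := hmom hvm_meas hvm_le
  have hpPN : ∫ t, v t * weilThetaPhi t = P - N := by
    rw [hP, hN, ← integral_sub hvpΦ hvmΦ]
    refine integral_congr_ae (ae_of_all _ fun t => ?_)
    simp only [hvp, hvm]
    rw [← sub_mul, max_zero_sub_max_neg_zero_eq_self]
  rw [hpPN] at hmain
  -- case split on the sign of `ε(a)`
  by_cases hε : 0 ≤ weilGroundEnergy a
  · linarith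
  · have hε' : weilGroundEnergy a < 0 := not_le.1 hε
    -- `ε (P - N) ≤ ε · (2/3) P` and `-(4/3) e P ≤ ε (P - N)`
    have h1 : weilGroundEnergy a * (P - N) ≤ weilGroundEnergy a * (2 / 3 * P) :=
      mul_le_mul_of_nonpos_left (by linarith) hε'.le
    have h2 : -(4 / 3 * (groundBartaRate a * P)) ≤ weilGroundEnergy a * (2 / 3 * P) := by
      have hR0 : 0 ≤ R := by
        have := leakNeg_primeMajorant_nonneg a
        have := weilThetaPhi_pos a
        have : 0 ≤ ∫ t, vm t := integral_nonneg hvm0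
        rw [hR]; positivity
      linarith
    by_cases hP' : P = 0
    · -- then `N = 0`, `u = 0` a.e. on the window: impossible for a normalised ground state;
      -- but we do not even need this: with `P = 0` the inequality `h2` is `0 ≤ 0`-vacuous, so argue
      -- directly from the normalisation.
      exfalso
      have hN' : N = 0 := le_antisymm (by linarith) hN0
      have hvpΦ0 : (fun t => vp t * weilThetaPhi t) =ᵐ[volume] 0 :=
        (integral_eq_zero_iff_of_nonneg (fun t => mul_nonneg (hvp0 t) (weilThetaPhi_pos t).le)
          hvpΦ).1 hP'
      have hvmΦ0 : (fun t => vm t * weilThetaPhi t) =ᵐ[volume] 0 :=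
        (integral_eq_zero_iff_of_nonneg (fun t => mul_nonneg (hvm0 t) (weilThetaPhi_pos t).le)
          hvmΦ).1 hN'
      have hnull : (volume : Measure ℝ) {-a, a} = 0 := (Set.toFinite _).measure_zero volume
      have hae2 := measure_eq_zero_iff_ae_notMem.1 hnull
      have hu0 : ∀ᵐ t : ℝ, u t = 0 := by
        filter_upwards [hvpΦ0, hvmΦ0, hreal, hu.ae_eq_zero_of_notMem, hae2] with t h0 h0' h1 h3 h4
        simp only [Pi.zero_apply, mul_eq_zero, (weilThetaPhi_pos t).ne', or_false] at h0 h0'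
        by_cases ht : t ∈ Ioo (-a) a
        · have hv0 : v t = 0 := by
            have e := max_zero_sub_max_neg_zero_eq_self (v t)
            simp only [hvp, hvm] at h0 h0'
            rw [h0, h0'] at e; simpa using e.symm
          have hre : (u t).re = 0 := by simpa [hv, indicator_of_mem ht] using hv0
          exact Complex.ext hre (h1 ht)
        · have hm : t ∉ Icc (-a) a := by
            intro hm
            simp only [mem_insert_iff, mem_singleton_iff, not_or] at h4
            exact ht ⟨lt_of_le_of_ne hm.1 (fun h => h4.1 h.symm), lt_of_le_of_ne hm.2 h4.2⟩
          exact h3 hm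
      have : ∫ t, ‖u t‖ ^ 2 = 0 := by
        rw [← integral_zero (α := ℝ)]
        exact integral_congr_ae (hu0.mono fun t ht => by simp [ht])
      linarith [hu.integral_norm_sq]
    · have hPpos : 0 < P := lt_of_le_of_ne hP0 (Ne.symm hP')
      have h3 : -(4 / 3 * (groundBartaRate a * P)) ≤ weilGroundEnergy a * (2 / 3 * P) := h2
      -- divide by `(2/3) P > 0`
      have h4 : -(2 * groundBartaRate a) * (2 / 3 * P) ≤ weilGroundEnergy a * (2 / 3 * P) := by
        linarith
      exact le_of_mul_le_mul_right h4 (by positivity)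

/-! ## The robust rung -/

/-- **The robust ground Barta floor (rung form).**  With `e' = 2·groundBartaRate` (`→ 0`) and
`a₀ = 1`: at every window `a ≥ 1` carrying a ROBUSTLY SIGNED ground state (`Im u = 0` a.e. on the
window, `∫ v⁻Φ ≤ (1/3)∫ v⁺Φ`, `R_a(v⁻) ≤ (1/3)e(a)∫ v⁺Φ`), every normalised window test has
`Re Q(h) ≥ -e'(a)`. [cite: Bombieri2000Weil, §4 Lemma 1] -/
theorem robustGroundBartaFloor :
    ∃ e : ℝ → ℝ, Tendsto e atTop (nhds 0) ∧ ∃ a₀ : ℝ, ∀ a : ℝ, a₀ ≤ a →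
      (∃ u : ℝ → ℂ, IsWeilGroundState a u ∧ (∀ᵐ t : ℝ, t ∈ Ioo (-a) a → (u t).im = 0) ∧
        ((∫ t, max (-(Ioo (-a) a).indicator (fun t => (u t).re) t) 0 * weilThetaPhi t) ≤
          (1 / 3) * (∫ t, max ((Ioo (-a) a).indicator (fun t => (u t).re) t) 0 * weilThetaPhi t)) ∧
        ((2 * ∑' n : ℕ, (Λ n : ℝ) / Real.sqrt n * weilThetaPhi (max a (Real.log n - a))) *
              (∫ t, max (-(Ioo (-a) a).indicator (fun t => (u t).re) t) 0) +
            weilThetaPhi a *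
              (4 * Real.sqrt (∫ t, max (-(Ioo (-a) a).indicator (fun t => (u t).re) t) 0 ^ 2) +
                8 * (∫ t, max (-(Ioo (-a) a).indicator (fun t => (u t).re) t) 0)) ≤
          (1 / 3) * (groundBartaRate a *
            (∫ t, max ((Ioo (-a) a).indicator (fun t => (u t).re) t) 0 * weilThetaPhi t)))) →
      ∀ h : ℝ → ℂ, IsWeilTest h → tsupport h ⊆ Icc (-a) a → ∫ t, ‖h t‖ ^ 2 = (1 : ℝ) →
        -e a ≤ (weilQuadratic h).re := by
  have hdec : Tendsto groundBartaRate atTop (nhds 0) := stub_groundRateDecay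
  refine ⟨fun a => 2 * groundBartaRate a, by simpa using hdec.const_mul (2 : ℝ), 1,
    fun a ha hgood h hh hs hnorm => ?_⟩
  obtain ⟨u, hu, hreal, hneg, hleak⟩ := hgood
  have ha0 : 0 < a := one_pos.trans_le ha
  exact (robustBarta_floor ha0 hu hreal hneg hleak).trans
    (PolarPerronFrobenius.weilGroundEnergy_le_of_sphere hh hs hnorm)

/-! ## The robust route closes: deciding theorems -/

/-- **DECIDING THEOREM of the robust route (no parity input).**  If beyond every height some
window carries a ROBUSTLY SIGNED ground state of the full windowed Weil form, the Riemann
Hypothesis holds: otherwise the detector `OddNegativityOffLine` (PROVED, Yoshida's odd criterion)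
gives normalised odd window tests of energy `≤ -η` at all large windows, contradicting the robust
floor `-2e(a) ≤ ε(a)` with `e(a) → 0`. [cite: Bombieri2000Weil, §4; Yoshida1992HermitianForms, Prop. 1(1)] -/
theorem riemannHypothesis_of_cofinal_robustGroundState
    (hRob : ∀ A : ℝ, ∃ a : ℝ, A ≤ a ∧ ∃ u : ℝ → ℂ, IsWeilGroundState a u ∧
      (∀ᵐ t : ℝ, t ∈ Ioo (-a) a → (u t).im = 0) ∧
      ((∫ t, max (-(Ioo (-a) a).indicator (fun t => (u t).re) t) 0 * weilThetaPhi t) ≤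
        (1 / 3) * (∫ t, max ((Ioo (-a) a).indicator (fun t => (u t).re) t) 0 * weilThetaPhi t)) ∧
      ((2 * ∑' n : ℕ, (Λ n : ℝ) / Real.sqrt n * weilThetaPhi (max a (Real.log n - a))) *
            (∫ t, max (-(Ioo (-a) a).indicator (fun t => (u t).re) t) 0) +
          weilThetaPhi a *
            (4 * Real.sqrt (∫ t, max (-(Ioo (-a) a).indicator (fun t => (u t).re) t) 0 ^ 2) +
              8 * (∫ t, max (-(Ioo (-a) a).indicator (fun t => (u t).re) t) 0)) ≤
        (1 / 3) * (groundBartaRate a *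
          (∫ t, max ((Ioo (-a) a).indicator (fun t => (u t).re) t) 0 * weilThetaPhi t)))) :
    RiemannHypothesis := by
  by_contra hRH
  have hNeg : ¬ RiemannHypothesis → ∃ η : ℝ, 0 < η ∧ ∃ A : ℝ, ∀ a : ℝ, A ≤ a → ∃ h : ℝ → ℂ,
      IsWeilTest h ∧ tsupport h ⊆ Set.Icc (-a) a ∧ (∀ t, h (-t) = -h t) ∧
      ∫ t, ‖h t‖ ^ 2 = (1 : ℝ) ∧ (weilQuadratic h).re ≤ -η :=
    GroundBarta.oddNegativityOffLine_proof
  obtain ⟨η, hη, A, hAneg⟩ := hNeg hRH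
  obtain ⟨e, he, a₀, hfloor⟩ := robustGroundBartaFloor
  have hev : ∀ᶠ a in Filter.atTop, e a < η := he.eventually (Iio_mem_nhds hη)
  obtain ⟨A₁, hA₁⟩ := Filter.eventually_atTop.1 hev
  obtain ⟨a, ha, u, hu⟩ := hRob (max (max A a₀) A₁)
  have haA : A ≤ a := le_trans (le_trans (le_max_left _ _) (le_max_left _ _)) ha
  have ha₀ : a₀ ≤ a := le_trans (le_trans (le_max_right _ _) (le_max_left _ _)) ha
  have haA₁ : A₁ ≤ a := le_trans (le_max_right _ _) ha
  obtain ⟨h, hh, hsupp, -, hnorm, hneg⟩ := hAneg a haA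
  have h1 := hfloor a ha₀ ⟨u, hu⟩ h hh hsupp hnorm
  have h2 : e a < η := hA₁ a haA₁
  linarith

/-- **The robust twin of `PolarPerronFrobenius` closes the route.**  `RobustPolarPerronFrobenius`
(spelled inline: beyond every height there is a window `a` at which, IF the even sector carries
the bottom (`EW a`), some ground state is robustly signed) and `EvenWinsBeyondArch` imply RH.
[cite: Bombieri2000Weil, §4; Yoshida1992HermitianForms, Prop. 1(1)] -/
theorem riemannHypothesis_of_robustPolarPerronFrobenius
    (hRobPF : ∀ A : ℝ, ∃ a : ℝ, A ≤ a ∧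
      ((∀ o : ℝ → ℂ, IsWeilTest o → tsupport o ⊆ Icc (-a) a → (∀ t, o (-t) = -o t) →
          ∫ t, ‖o t‖ ^ 2 = (1 : ℝ) → ∀ δ : ℝ, 0 < δ → ∃ w : ℝ → ℂ, IsWeilTest w ∧
            tsupport w ⊆ Icc (-a) a ∧ (∀ t, w (-t) = w t) ∧ ∫ t, ‖w t‖ ^ 2 = (1 : ℝ) ∧
            (weilQuadratic w).re ≤ (weilQuadratic o).re + δ) →
        ∃ u : ℝ → ℂ, IsWeilGroundState a u ∧ (∀ᵐ t : ℝ, t ∈ Ioo (-a) a → (u t).im = 0) ∧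
        ((∫ t, max (-(Ioo (-a) a).indicator (fun t => (u t).re) t) 0 * weilThetaPhi t) ≤
          (1 / 3) * (∫ t, max ((Ioo (-a) a).indicator (fun t => (u t).re) t) 0 * weilThetaPhi t)) ∧
        ((2 * ∑' n : ℕ, (Λ n : ℝ) / Real.sqrt n * weilThetaPhi (max a (Real.log n - a))) *
              (∫ t, max (-(Ioo (-a) a).indicator (fun t => (u t).re) t) 0) +
            weilThetaPhi a *
              (4 * Real.sqrt (∫ t, max (-(Ioo (-a) a).indicator (fun t => (u t).re) t) 0 ^ 2) +
                8 * (∫ t, max (-(Ioo (-a) a).indicator (fun t => (u t).re) t) 0)) ≤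
          (1 / 3) * (groundBartaRate a *
            (∫ t, max ((Ioo (-a) a).indicator (fun t => (u t).re) t) 0 * weilThetaPhi t)))))
    (hEven : Summit.RiemannHypothesis.RiemannHypothesis.Theses.GroundBarta.EvenWinsBeyondArch) :
    RiemannHypothesis := by
  have hEW : ∀ a : ℝ, Real.log 2 / 2 < a → ∀ o : ℝ → ℂ, IsWeilTest o →
      tsupport o ⊆ Icc (-a) a → (∀ t, o (-t) = -o t) → ∫ t, ‖o t‖ ^ 2 = (1 : ℝ) → ∀ δ : ℝ, 0 < δ →
      ∃ w : ℝ → ℂ, IsWeilTest w ∧ tsupport w ⊆ Icc (-a) a ∧ (∀ t, w (-t) = w t) ∧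
        ∫ t, ‖w t‖ ^ 2 = (1 : ℝ) ∧ (weilQuadratic w).re ≤ (weilQuadratic o).re + δ := hEven
  refine riemannHypothesis_of_cofinal_robustGroundState fun A => ?_
  obtain ⟨a, ha, hgood⟩ := hRobPF (max A 1)
  have haA : A ≤ a := le_trans (le_max_left _ _) ha
  have ha1 : (1 : ℝ) ≤ a := le_trans (le_max_right _ _) ha
  have hlog : Real.log 2 / 2 < a := by
    have h2 : Real.log 2 < 0.6931471808 := Real.log_two_lt_d9
    linarith
  exact ⟨a, haA, hgood (hEW a hlog)⟩

/-- **`PolarPerronFrobenius` implies its robust twin**: a ground state that is real and `≥ 0` a.e.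
on the open window has `v⁻ = 0`, so both smallness conditions hold trivially. [folklore] -/
theorem robustPolarPerronFrobenius_of_polarPerronFrobenius
    (hPF : Summit.RiemannHypothesis.RiemannHypothesis.Theses.GroundBarta.PolarPerronFrobenius) :
    ∀ A : ℝ, ∃ a : ℝ, A ≤ a ∧
      ((∀ o : ℝ → ℂ, IsWeilTest o → tsupport o ⊆ Icc (-a) a → (∀ t, o (-t) = -o t) →
          ∫ t, ‖o t‖ ^ 2 = (1 : ℝ) → ∀ δ : ℝ, 0 < δ → ∃ w : ℝ → ℂ, IsWeilTest w ∧
            tsupport w ⊆ Icc (-a) a ∧ (∀ t, w (-t) = w t) ∧ ∫ t, ‖w t‖ ^ 2 = (1 : ℝ) ∧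
            (weilQuadratic w).re ≤ (weilQuadratic o).re + δ) →
        ∃ u : ℝ → ℂ, IsWeilGroundState a u ∧ (∀ᵐ t : ℝ, t ∈ Ioo (-a) a → (u t).im = 0) ∧
        ((∫ t, max (-(Ioo (-a) a).indicator (fun t => (u t).re) t) 0 * weilThetaPhi t) ≤
          (1 / 3) * (∫ t, max ((Ioo (-a) a).indicator (fun t => (u t).re) t) 0 * weilThetaPhi t)) ∧
        ((2 * ∑' n : ℕ, (Λ n : ℝ) / Real.sqrt n * weilThetaPhi (max a (Real.log n - a))) *
              (∫ t, max (-(Ioo (-a) a).indicator (fun t => (u t).re) t) 0) +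
            weilThetaPhi a *
              (4 * Real.sqrt (∫ t, max (-(Ioo (-a) a).indicator (fun t => (u t).re) t) 0 ^ 2) +
                8 * (∫ t, max (-(Ioo (-a) a).indicator (fun t => (u t).re) t) 0)) ≤
          (1 / 3) * (groundBartaRate a *
            (∫ t, max ((Ioo (-a) a).indicator (fun t => (u t).re) t) 0 * weilThetaPhi t)))) := by
  intro A
  obtain ⟨a, ha, hmat⟩ :=
    (PolarPerronFrobenius.polarPerronFrobenius_iff_groundEnergy.1 hPF) (max A 1)
  have haA : A ≤ a := (le_max_left _ _).trans ha
  have ha0 : 0 < a := one_pos.trans_le ((le_max_right _ _).trans ha)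
  refine ⟨a, haA, fun hEW => ?_⟩
  obtain ⟨u, hu, hsign⟩ :=
    hmat (PolarPerronFrobenius.weilEvenGroundEnergy_le_weilOddGroundEnergy_of_evenWinsAt ha0 hEW)
  have hvm0 : (fun t => max (-(Ioo (-a) a).indicator (fun t => (u t).re) t) 0) =ᵐ[volume] 0 := by
    filter_upwards [hsign] with t ht
    by_cases hm : t ∈ Ioo (-a) a
    · simp only [indicator_of_mem hm, Pi.zero_apply, max_eq_right_iff, neg_nonpos]
      exact (ht hm).2
    · simp only [indicator_of_notMem hm, neg_zero, max_self, Pi.zero_apply]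
  have hI1 : ∫ t, max (-(Ioo (-a) a).indicator (fun t => (u t).re) t) 0 * weilThetaPhi t = 0 :=
    integral_eq_zero_of_ae (by
      filter_upwards [hvm0] with t ht
      simp only [Pi.zero_apply] at ht ⊢
      rw [ht, zero_mul])
  have hI2 : ∫ t, max (-(Ioo (-a) a).indicator (fun t => (u t).re) t) 0 = 0 :=
    integral_eq_zero_of_ae hvm0
  have hI3 : ∫ t, max (-(Ioo (-a) a).indicator (fun t => (u t).re) t) 0 ^ 2 = 0 :=
    integral_eq_zero_of_ae (by
      filter_upwards [hvm0] with t ht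
      simp only [Pi.zero_apply] at ht ⊢
      rw [ht]; ring)
  have hP0 : 0 ≤ ∫ t, max ((Ioo (-a) a).indicator (fun t => (u t).re) t) 0 * weilThetaPhi t :=
    integral_nonneg fun t => mul_nonneg (le_max_right _ _) (weilThetaPhi_pos t).le
  have he0 : 0 ≤ groundBartaRate a := groundBartaRate_nonneg a
  refine ⟨u, hu, hsign.mono fun t ht hm => (ht hm).1, ?_, ?_⟩
  · rw [hI1]; positivity
  · rw [hI2, hI3, Real.sqrt_zero]
    have : 0 ≤ 1 / 3 * (groundBartaRate a *
        (∫ t, max ((Ioo (-a) a).indicator (fun t => (u t).re) t) 0 * weilThetaPhi t)) := by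
      positivity
    simpa using this

end Summit.RiemannHypothesis.RiemannHypothesis.Theorems.GroundBartaFloor

end
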